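import Summits.ValiantsHypothesis.ValiantsHypothesis.Theorems.DivisionGapPerDivisionHardStubTorus
import Literature.Computability.AlgebraicComplexity.CircuitDepthProofs

/-!
# Crux `DivisionGap.PerDivisionHard` (stmt-ValiantsHypothesis-5065), line
`pair-descent-jss-endpoint` — stub `stub_formulaTorus`: the torus normal form is free for
monotone FORMULAS too

For every nonzero `h ∈ ℝ≥0[x_ij]` in the `n × n` matrix variables there is a nonzero
torus-homogeneous `h'` (`IsTorusHomogeneous h'`: all monomials share the row-margin vector and
the column-margin vector) with `L(per_n · h') ≤ L(per_n · h)` in the tree's monotone fan-in-two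
`complexity` over `ℝ≥0` AND `E(h') ≤ E(h)` in the monotone fan-in-two FORMULA size
`formulaComplexity` over `ℝ≥0`.

Proof.  The `h'` of `stub_torus` (`Theorems/DivisionGapPerDivisionHardStubTorus.lean`: two
digit-weight initial forms, rows then columns) works; the only new ingredient is that initial
forms are free for monotone formulas as well (`formulaComplexity_topComponent_le`).  The pruned
circuit `prune w P` of `ZeroOneTransfer/Negative/TopComponentFree.lean` keeps the output operand
and replaces the operand list of every sum gate by a SUBLIST (`List.filter`), product gates being
unchanged (`args_pruneGate_sublist`); hence its list of operand occurrences is a sublist of that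
of `P` (`operands_prune_sublist`) and every gate index is still referenced at most once
(`List.Sublist.countP_le`): `IsFormula (prune w P)` (`isFormula_prune`).  With
`isFanInTwo_prune`, `eval_prune`, `size_prune` and the attainment of `formulaComplexity`
(`ArithCircuit.exists_computes_size_eq_formulaComplexity`, `formulaComplexity_le_size`) this
gives `E(top_w p) ≤ E(p)`; the permanent is homogeneous for both digit weights, so
`top (per · p) = per · top p` and the `complexity` bounds are those of `stub_torus`. [folklore]
-/

noncomputable section

-- `Summit.ValiantsHypothesis.ValiantsHypothesis.…` is the tree's mandated single-conjunct layout
-- (Sub = Summit), so the duplicated namespace component is intended.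
set_option linter.dupNamespace false

namespace Summit.ValiantsHypothesis.ValiantsHypothesis.Theorems.DivisionGapPerDivisionHard

open MvPolynomial Literature.Computability.AlgebraicComplexity
open Summit.ValiantsHypothesis.ValiantsHypothesis.Theorems.ZeroOneTransfer.Negative
open scoped NNReal

/-! ### Pruning a monotone circuit to its top component keeps formulas -/

section Prune

variable {σ : Type*} (w : σ → ℕ)

open ArithCircuit (Gate Operand)

/-- The operands of a pruned gate form a sublist of the operands of the original gate: a sum
gate keeps a `List.filter` of its (coefficient, operand) pairs, a product gate is unchanged.
[folklore] -/
theorem args_pruneGate_sublist (vals : List (MvPolynomial σ ℝ≥0)) (g : Gate ℝ≥0 σ) :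
    (pruneGate w vals g).args.Sublist g.args := by
  cases g with
  | sum args =>
    simp only [pruneGate, ArithCircuit.Gate.args]
    exact List.filter_sublist.map _
  | prod args => exact List.Sublist.refl _

/-- The operand occurrences of a pruned gate list form a sublist of those of the original gate
list (gate by gate, `args_pruneGate_sublist`). [folklore] -/
theorem flatMap_args_pruneAux_sublist (gs : List (Gate ℝ≥0 σ)) :
    ((pruneAux w gs).1.flatMap Gate.args).Sublist (gs.flatMap Gate.args) := by
  induction gs using List.reverseRecOn with
  | nil => simp [pruneAux]
  | append_singleton gs g ih =>
    rw [pruneAux_append_singleton, List.flatMap_append, List.flatMap_append]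
    refine ih.append ?_
    simpa using args_pruneGate_sublist w _ g

/-- The operand occurrences of the pruned circuit form a sublist of those of the original
circuit (same output operand). [folklore] -/
theorem operands_prune_sublist (P : ArithCircuit ℝ≥0 σ) :
    (prune w P).operands.Sublist P.operands :=
  (flatMap_args_pruneAux_sublist w P.gates).append (List.Sublist.refl _)

/-- **Pruning keeps formulas**: every gate index is referenced at most as often in the pruned
circuit as in the original one (`List.Sublist.countP_le`). [folklore] -/
theorem isFormula_prune {P : ArithCircuit ℝ≥0 σ} (h : P.IsFormula) : (prune w P).IsFormula :=
  fun j => ((operands_prune_sublist w P).countP_le).trans (h j)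

/-- **Initial forms are free for monotone formulas over `ℝ≥0`**: `E(top_w p) ≤ E(p)` in the
tree's fan-in-two `formulaComplexity` over the semiring `ℝ≥0`, for every weight `w : σ → ℕ`
(prune a size-optimal formula for `p`). [folklore] -/
theorem formulaComplexity_topComponent_le (p : MvPolynomial σ ℝ≥0) :
    formulaComplexity (topComponent w p) ≤ formulaComplexity p := by
  classical
  obtain ⟨P, h1, h2, hP, hsize⟩ := ArithCircuit.exists_computes_size_eq_formulaComplexity p
  rw [← hsize, ← size_prune w P]
  refine formulaComplexity_le_size (isFormula_prune w h1) (isFanInTwo_prune w h2) ?_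
  show (prune w P).eval = topComponent w p
  rw [eval_prune, show P.eval = p from hP]

end Prune

/-! ### One torus step, with the formula bound -/

variable {n : ℕ}

/-- **One torus step, formula version.**  For `p ≠ 0` the top component `p'` of `p` for the
digit weight of `f` (radix `deg p + 1`) is nonzero, has its support inside that of `p`, has
constant `f`-margins, and costs nothing in either measure: `L(per · p') ≤ L(per · p)` (the
permanent is homogeneous, top components are multiplicative and free over `ℝ≥0`) and
`E(p') ≤ E(p)` (`formulaComplexity_topComponent_le`). [folklore] -/
theorem exists_topComponent_const_margins_formula (f : Fin n × Fin n → Fin n)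
    (hf : ∀ (B : ℕ) (π : Equiv.Perm (Fin n)),
      ∑ i : Fin n, B ^ ((f (π i, i) : Fin n) : ℕ) = ∑ a : Fin n, B ^ ((a : Fin n) : ℕ))
    {p : MvPolynomial (Fin n × Fin n) ℝ≥0} (hp : p ≠ 0) :
    ∃ p' : MvPolynomial (Fin n × Fin n) ℝ≥0, p' ≠ 0 ∧ p'.support ⊆ p.support ∧
      (∀ m ∈ p'.support, ∀ m' ∈ p'.support, Finsupp.mapDomain f m = Finsupp.mapDomain f m') ∧
      complexity (perPoly (Fin n) ℝ≥0 * p') ≤ complexity (perPoly (Fin n) ℝ≥0 * p) ∧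
      formulaComplexity p' ≤ formulaComplexity p := by
  set W : Fin n × Fin n → ℕ := fun v => (p.totalDegree + 1) ^ ((f v : Fin n) : ℕ)
  refine ⟨topComponent W p, topComponent_ne_zero W hp, support_topComponent_subset W p,
    fun m hm m' hm' => mapDomain_eq_of_mem_support_topComponent f p hm hm', ?_,
    formulaComplexity_topComponent_le W p⟩
  have := complexity_topComponent_le W (perPoly (Fin n) ℝ≥0 * p)
  rwa [topComponent_mul, topComponent_eq_self_of_isWeightedHomogeneous W
    (isWeightedHomogeneous_perPoly_digitWeight f _ (hf _))] at this

/-! ### The stub -/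

/-- **`stub_formulaTorus` (line `pair-descent-jss-endpoint` for `PerDivisionHard`).**  Every
nonzero cofactor `h ∈ ℝ≥0[x_ij]` may be replaced by a nonzero TORUS-HOMOGENEOUS `h'` (all
monomials share the row-margin vector and the column-margin vector) at no cost in the monotone
circuit complexity of the product, `L(per_n · h') ≤ L(per_n · h)`, nor in the monotone FORMULA
complexity of the cofactor, `E(h') ≤ E(h)`.  Two initial-form steps
(`exists_topComponent_const_margins_formula` for `Prod.fst`, then for `Prod.snd`; supports only
shrink, so the row margins stay constant), reading `r`, `c` off one monomial of `h'`.
[folklore] -/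
theorem stub_formulaTorus :
    ∀ (n : ℕ) (h : MvPolynomial (Fin n × Fin n) ℝ≥0), h ≠ 0 →
      ∃ h' : MvPolynomial (Fin n × Fin n) ℝ≥0, h' ≠ 0 ∧ IsTorusHomogeneous h' ∧
        complexity (perPoly (Fin n) ℝ≥0 * h') ≤ complexity (perPoly (Fin n) ℝ≥0 * h) ∧
        formulaComplexity h' ≤ formulaComplexity h := by
  intro n h hh
  -- row step: `per` is row-homogeneous since `i ↦ π i` is a bijection
  obtain ⟨h₁, hh₁, -, hrow, hle₁, hle₁'⟩ := exists_topComponent_const_margins_formula Prod.fst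
    (fun B π => Equiv.sum_comp π (fun a : Fin n => B ^ ((a : Fin n) : ℕ))) hh
  -- column step: `per` is column-homogeneous trivially
  obtain ⟨h₂, hh₂, hsub, hcol, hle₂, hle₂'⟩ :=
    exists_topComponent_const_margins_formula Prod.snd (fun B π => rfl) hh₁
  obtain ⟨d₀, hd₀⟩ := exists_coeff_ne_zero hh₂
  have hd₀s : d₀ ∈ h₂.support := mem_support_iff.mpr hd₀
  refine ⟨h₂, hh₂, ⟨rowDegrees d₀, Finsupp.mapDomain Prod.snd d₀, fun m hm => ⟨?_, ?_⟩⟩,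
    hle₂.trans hle₁, hle₂'.trans hle₁'⟩
  · exact hrow m (hsub hm) d₀ (hsub hd₀s)
  · exact hcol m hm d₀ hd₀s

end Summit.ValiantsHypothesis.ValiantsHypothesis.Theorems.DivisionGapPerDivisionHard

end
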